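import Summits.BirchSwinnertonDyer.Rank1Residual.X12.CMRamifiedRecordBridge
import HarnessLib

/-!
# Leaf `CornerF ∧ CMRamified`, slice `p = 3`: PART F §1 addendum — sixth-power invariance of the closed
# forms and the bridge for the PART C FRAME records (`FrameThreeRow.subLeaf` = both O11@3 binders ∧ away bit, BY NAME)

HONEST FRAMING (cell `bsd-print-cfram`, run/shared/lean/pub/bsd-print-cfram/, verbatim in every file
of the cell): PARTITION currency only — the leaf counts when its class theorem is in the kernel BY
NAME, flag-free; Literature named facts are statement-only with cite tags, never sorried theorems;
every imported theorem carries its printed hypotheses verbatim; numbers, not adjectives. THIS FILE IS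
STRUCTURE: theorems only, no definition, no named fact, nothing about any particular curve; no mark
moves (the leaf K12r, its `p = 3` slice and the regime children N / T / V of route `PrintCFram` stay OPEN).

WHAT IS HERE. PART C's frame records (`X12/CMRamifiedRecordSchemaC.lean`, displays
`CMRamifiedFrameThree{A..D}`, the data regime N's typed triple quantifies over) carry the twin as
`W' = E_{k'}` with `k'·w₁⁶ = −27·k·w₂⁶` (NOT literally `−27k`) and the bit `subLeaf = ¬hasLocal3Tors k ∧
¬hasLocal3Tors k' ∧ awayOK` (`subLeaf_eq_of_consistent`). To put these under the PART F §1 bridge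
(`tBit_eq_false_iff_noThreeTorsion_pair`, stated with `−27k`) one needs that the closed forms only
depend on the class of `k` modulo sixth powers: §1 `isSqQ3_mul_pow_six`, `isCubeQ3_eq_true_iff`
(`isCubeQ3 (3ᵃm) ⟺ 3 ∣ a ∧ m ≡ ±1 (mod 9)`), `isCubeQ3_mul_pow_six`, `hasLocal3Tors_mul_pow_six`,
`hasLocal3Tors_eq_of_twist` (`k'·w₁⁶ = −27·k·w₂⁶ ⟹ hasLocal3Tors k' = hasLocal3Tors (−27k)`); §2
**`FrameThreeRow.subLeaf_eq_tBit`** (a consistent frame record's `subLeaf = ¬T-bit(k) ∧ awayOK`) and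
**`FrameThreeRow.subLeaf_iff_binders`**: for ANY `W` over `ℚ` with `C • W = (y² = x³ + r.k)`,
`r.subLeaf = true ⟺ (W(ℚ₃)[3] = 0 ∧ W^{(−3)}(ℚ₃)[3] = 0) ∧ awayOK r.tam` — so `checked_frameThree_{A..D}`
(p545358/p545675/p546225/p546496) discharge the binders `htors ∧ htors'` of the O11@3 triple on their
45 sub-leaf classes and refute them on the other 55 BY NAME (p4 p546152 underneath). beyond-print: NO.
-/

set_option autoImplicit false

namespace Summit.BirchSwinnertonDyer.Rank1Residual.X12.CMRamifiedRecords

open Summit.BirchSwinnertonDyer.BirchSwinnertonDyer.Rank1Residual.HeegnerIndexRecords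

/-! ### §1 The closed forms depend only on `k` modulo sixth powers -/

/-- A `3`-adic unit is a sixth root of unity mod `3` and mod `9`: `(t : ZMod 3)^6 = 1` and
`(t : ZMod 9)^6 = 1` for `3 ∤ t`. [folklore] -/
theorem pow_six_cast_eq_one {t : ℤ} (ht : ¬ (3 : ℤ) ∣ t) :
    ((t : ZMod 3)) ^ 6 = 1 ∧ ((t : ZMod 9)) ^ 6 = 1 := by
  have e3 : (t : ZMod 3) = ((t % 3 : ℤ) : ZMod 3) := by
    rw [ZMod.intCast_eq_intCast_iff']; push_cast; omega
  have e9 : (t : ZMod 9) = ((t % 9 : ℤ) : ZMod 9) := by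
    rw [ZMod.intCast_eq_intCast_iff']; push_cast; omega
  have h3 : t % 3 = 1 ∨ t % 3 = 2 := by omega
  have h9 : t % 9 = 1 ∨ t % 9 = 2 ∨ t % 9 = 4 ∨ t % 9 = 5 ∨ t % 9 = 7 ∨ t % 9 = 8 := by omega
  rw [e3, e9]
  constructor
  · rcases h3 with h | h <;> rw [h] <;> decide
  · rcases h9 with h | h | h | h | h | h <;> rw [h] <;> decide

/-- `(m : ZMod 9) = 1 ⟺ m % 9 = 1` and `(m : ZMod 9) = 8 ⟺ m % 9 = 8`. [folklore] -/
theorem intCast_zmod_nine_eq_iff (m : ℤ) :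
    ((m : ZMod 9) = 1 ↔ m % 9 = 1) ∧ ((m : ZMod 9) = 8 ↔ m % 9 = 8) := by
  have e : (m : ZMod 9) = ((m % 9 : ℤ) : ZMod 9) := by
    rw [ZMod.intCast_eq_intCast_iff']; push_cast; omega
  have h9 : m % 9 = 0 ∨ m % 9 = 1 ∨ m % 9 = 2 ∨ m % 9 = 3 ∨ m % 9 = 4 ∨ m % 9 = 5 ∨ m % 9 = 6 ∨
      m % 9 = 7 ∨ m % 9 = 8 := by omega
  rw [e]
  rcases h9 with h | h | h | h | h | h | h | h | h <;> rw [h] <;> decide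

/-- `3 ∤ m`, `3 ∤ t` ⟹ `3 ∤ m·t⁶`. [folklore] -/
theorem not_three_dvd_mul_pow_six {m t : ℤ} (hm : ¬ (3 : ℤ) ∣ m) (ht : ¬ (3 : ℤ) ∣ t) :
    ¬ (3 : ℤ) ∣ m * t ^ 6 := by
  intro h
  rcases Int.prime_three.dvd_mul.mp h with h | h
  · exact hm h
  · exact ht (Int.prime_three.dvd_of_dvd_pow h)

/-- **`isSqQ3` is invariant under `n ↦ n·w⁶`** (`w ≠ 0`). [cite: Serre1973, Ch. II §3.3 Thm 3] -/
theorem isSqQ3_mul_pow_six (n w : ℤ) (hw : w ≠ 0) : isSqQ3 (n * w ^ 6) = isSqQ3 n := by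
  by_cases hn : n = 0
  · subst hn; simp
  obtain ⟨a, m, hm, rfl⟩ := exists_eq_pow_mul_of_ne_zero hn
  obtain ⟨b, t, ht, rfl⟩ := exists_eq_pow_mul_of_ne_zero hw
  have hmt := not_three_dvd_mul_pow_six hm ht
  rw [show (3 : ℤ) ^ a * m * ((3 : ℤ) ^ b * t) ^ 6 = (3 : ℤ) ^ (a + 6 * b) * (m * t ^ 6) by ring,
    Bool.eq_iff_iff, isSqQ3_eq_true_iff hmt, isSqQ3_eq_true_iff hm, Nat.even_add]
  have h6 : Even (6 * b) := ⟨3 * b, by ring⟩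
  have hc : ((m * t ^ 6 : ℤ) : ZMod 3) = (m : ZMod 3) := by
    push_cast; rw [(pow_six_cast_eq_one ht).1, mul_one]
  rw [hc]
  simp [h6]

/-- **`isCubeQ3 (3ᵃ·m)` (`3 ∤ m`) iff `3 ∣ a` and `m ≡ ±1 (mod 9)`** (the cubes of `ℤ₃ˣ` are the units
`≡ ±1 (mod 9)`). [folklore] -/
theorem isCubeQ3_eq_true_iff {a : ℕ} {m : ℤ} (hm : ¬ (3 : ℤ) ∣ m) :
    isCubeQ3 ((3 : ℤ) ^ a * m) = true ↔ 3 ∣ a ∧ ((m : ZMod 9) = 1 ∨ (m : ZMod 9) = 8) := by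
  have hm0 : m ≠ 0 := fun h => hm (h ▸ dvd_zero 3)
  have hk0 : (3 : ℤ) ^ a * m ≠ 0 := mul_ne_zero (pow_ne_zero _ (by norm_num)) hm0
  rw [(intCast_zmod_nine_eq_iff m).1, (intCast_zmod_nine_eq_iff m).2, Nat.dvd_iff_mod_eq_zero]
  simp only [isCubeQ3, vp_three_eq hm, unit3_eq hm, Bool.and_eq_true, Bool.or_eq_true, bne_iff_ne,
    ne_eq, beq_iff_eq]
  constructor
  · rintro ⟨⟨-, h1⟩, h2⟩
    exact ⟨h1, h2⟩
  · rintro ⟨h1, h2⟩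
    exact ⟨⟨hk0, h1⟩, h2⟩

/-- **`isCubeQ3` is invariant under `n ↦ n·w⁶`** (`w ≠ 0`). [folklore] -/
theorem isCubeQ3_mul_pow_six (n w : ℤ) (hw : w ≠ 0) : isCubeQ3 (n * w ^ 6) = isCubeQ3 n := by
  by_cases hn : n = 0
  · subst hn; simp
  obtain ⟨a, m, hm, rfl⟩ := exists_eq_pow_mul_of_ne_zero hn
  obtain ⟨b, t, ht, rfl⟩ := exists_eq_pow_mul_of_ne_zero hw
  have hmt := not_three_dvd_mul_pow_six hm ht
  rw [show (3 : ℤ) ^ a * m * ((3 : ℤ) ^ b * t) ^ 6 = (3 : ℤ) ^ (a + 6 * b) * (m * t ^ 6) by ring,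
    Bool.eq_iff_iff, isCubeQ3_eq_true_iff hmt, isCubeQ3_eq_true_iff hm]
  have hc : ((m * t ^ 6 : ℤ) : ZMod 9) = (m : ZMod 9) := by
    push_cast; rw [(pow_six_cast_eq_one ht).2, mul_one]
  have h6 : 3 ∣ a + 6 * b ↔ 3 ∣ a := by omega
  rw [hc, h6]

/-- **`hasLocal3Tors` is invariant under `n ↦ n·w⁶`** (`w ≠ 0`): `E_{n w⁶} ≅ E_n` over `ℚ`. [folklore] -/
theorem hasLocal3Tors_mul_pow_six (n w : ℤ) (hw : w ≠ 0) :
    hasLocal3Tors (n * w ^ 6) = hasLocal3Tors n := by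
  simp only [hasLocal3Tors]
  rw [show (-4 : ℤ) * (n * w ^ 6) = (-4 * n) * w ^ 6 by ring,
    show (-3 : ℤ) * (n * w ^ 6) = (-3 * n) * w ^ 6 by ring,
    isSqQ3_mul_pow_six _ _ hw, isSqQ3_mul_pow_six _ _ hw, isCubeQ3_mul_pow_six _ _ hw]

/-- The twin relation of the record schemas, `k'·w₁⁶ = −27·k·w₂⁶` (`w₁, w₂ ≥ 1`), gives
`hasLocal3Tors k' = hasLocal3Tors (−27k)`. [folklore] -/
theorem hasLocal3Tors_eq_of_twist {k k' : ℤ} {w1 w2 : ℕ} (h1 : 1 ≤ w1) (h2 : 1 ≤ w2)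
    (h : k' * (w1 : ℤ) ^ 6 = -27 * k * (w2 : ℤ) ^ 6) :
    hasLocal3Tors k' = hasLocal3Tors (-27 * k) := by
  have hw1 : (w1 : ℤ) ≠ 0 := by exact_mod_cast (show w1 ≠ 0 by omega)
  have hw2 : (w2 : ℤ) ≠ 0 := by exact_mod_cast (show w2 ≠ 0 by omega)
  rw [← hasLocal3Tors_mul_pow_six k' (w1 : ℤ) hw1, h, hasLocal3Tors_mul_pow_six _ _ hw2]

/-! ### §2 The PART C frame records under the bridge -/

namespace FrameThreeRow

/-- From a consistent frame record: `k ≠ 0` and the twin relation `k'·w₁⁶ = −27·k·w₂⁶`, `w₁, w₂ ≥ 1`. [folklore] -/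
theorem twist_of_consistent {r : FrameThreeRow} (h : r.consistent = true) :
    r.k ≠ 0 ∧ 1 ≤ r.w1 ∧ 1 ≤ r.w2 ∧ r.k' * (r.w1 : ℤ) ^ 6 = -27 * r.k * (r.w2 : ℤ) ^ 6 := by
  obtain ⟨-, hm, -⟩ := (consistent_iff r).1 h
  simp only [modelOK, Bool.and_eq_true, bne_iff_ne, ne_eq, beq_iff_eq, decide_eq_true_eq] at hm
  obtain ⟨⟨⟨⟨⟨⟨⟨⟨⟨⟨⟨⟨⟨-, -⟩, -⟩, -⟩, hk⟩, -⟩, -⟩, -⟩, -⟩, -⟩, -⟩, hw1⟩, hw2⟩, htw⟩ := hm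
  exact ⟨hk, hw1, hw2, htw⟩

/-- **A consistent frame record's sub-leaf bit is `¬T-bit(k) ∧ away`**:
`r.subLeaf = !(hasLocal3Tors r.k ∨ hasLocal3Tors (−27·r.k)) ∧ awayOK r.tam`. [folklore] -/
theorem subLeaf_eq_tBit {r : FrameThreeRow} (h : r.consistent = true) :
    r.subLeaf = (!(hasLocal3Tors r.k || hasLocal3Tors (-27 * r.k)) && awayOK r.tam) := by
  obtain ⟨-, hw1, hw2, htw⟩ := twist_of_consistent h
  rw [subLeaf_eq_of_consistent h, hasLocal3Tors_eq_of_twist hw1 hw2 htw]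
  cases hasLocal3Tors r.k <;> cases hasLocal3Tors (-27 * r.k) <;> cases awayOK r.tam <;> rfl

section Curves

open scoped Classical
open WeierstrassCurve Literature.NumberTheory.EllipticCurves

/-- **PART C bridge.** For a consistent frame record `r` and ANY `W` over `ℚ` with Mordell model
`C • W = (y² = x³ + r.k)`: `r.subLeaf = true` iff both O11@3 binders hold (`W(ℚ₃)[3] = 0`,
`W^{(−3)}(ℚ₃)[3] = 0`; p4 p546152 by name via PART F §1) and the away bit `awayOK r.tam` is `true`.
[cite: SilvermanAEC2009, Exercise 3.7] -/
theorem subLeaf_iff_binders {r : FrameThreeRow} (h : r.consistent = true) (W : WeierstrassCurve ℚ)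
    {C : VariableChange ℚ} (hW : C • W = mordellCurve ((r.k : ℤ) : ℚ)) :
    r.subLeaf = true ↔
      (((∀ Q : (W.baseChange ℚ_[3]).toAffine.Point, (3 : ℕ) • Q = 0 → Q = 0) ∧
        (∀ Q : ((W.quadraticTwist (-3 : ℚ)).baseChange ℚ_[3]).toAffine.Point,
          (3 : ℕ) • Q = 0 → Q = 0)) ∧ awayOK r.tam = true) := by
  rw [subLeaf_eq_tBit h, Bool.and_eq_true, Bool.not_eq_true',
    tBit_eq_false_iff_noThreeTorsion_pair W (twist_of_consistent h).1 hW]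

/-- The two torsion bits alone: `torsFree3 ∧ torsFree3'` iff both O11@3 binders. [cite: SilvermanAEC2009, Exercise 3.7] -/
theorem torsFree_iff_binders {r : FrameThreeRow} (h : r.consistent = true) (W : WeierstrassCurve ℚ)
    {C : VariableChange ℚ} (hW : C • W = mordellCurve ((r.k : ℤ) : ℚ)) :
    (r.torsFree3 = true ∧ r.torsFree3' = true) ↔
      ((∀ Q : (W.baseChange ℚ_[3]).toAffine.Point, (3 : ℕ) • Q = 0 → Q = 0) ∧
        (∀ Q : ((W.quadraticTwist (-3 : ℚ)).baseChange ℚ_[3]).toAffine.Point,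
          (3 : ℕ) • Q = 0 → Q = 0)) := by
  obtain ⟨hk, hw1, hw2, htw⟩ := twist_of_consistent h
  obtain ⟨-, -, -, -, ht, -⟩ := (consistent_iff r).1 h
  simp only [torsOK, Bool.and_eq_true, beq_iff_eq] at ht
  obtain ⟨⟨⟨h1, -⟩, h2⟩, -⟩ := ht
  rw [← tBit_eq_false_iff_noThreeTorsion_pair W hk hW, h1, h2, hasLocal3Tors_eq_of_twist hw1 hw2 htw]
  cases hasLocal3Tors r.k <;> cases hasLocal3Tors (-27 * r.k) <;> simp

end Curves

end FrameThreeRow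

end Summit.BirchSwinnertonDyer.Rank1Residual.X12.CMRamifiedRecords
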